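import Literature.AlgebraicGeometry.ComplexMultiplication.CyclotomicFermatCMTypesTwoPrimeLevelSimple
import Literature.AlgebraicGeometry.ComplexMultiplication.CyclotomicFermatCMTypesThreePrimeLevelSimple
import Literature.AlgebraicGeometry.ComplexMultiplication.CyclotomicFermatCMTypesSixToNinePrimeLevelSimple
import HarnessLib

/-!
# Koblitz–Rohrlich 1978, §2: the Proposition — hence Theorems 1 (i)–(ii) and 2 in the relatively prime case — UNCONDITIONALLY at every level
# `N > 1` prime to `6` with at most nine prime factors

N. Koblitz, D. Rohrlich, *Simple factors in the Jacobian of a Fermat curve*, Canad. J. Math. **30** (1978) 1183–1205, §2 (pp. 1190–1192).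

THE SOURCE.  "PROPOSITION.  Suppose `2, 3 ∤ N`. Let `S(N)` be the set of odd characters of `(ℤ/Nℤ)^*`, and let `S₀(N) ⊂ S(N)` be the set of "bad"
characters, i.e., `S₀(N) = {χ ∈ S(N) | B_{1,χ} = 0}`.  Then `#S₀(N) < (1/6)#S(N)`" (p. 1190), proved case by case in `m = ω(N)`: "Case 1. `m = 2`",
"Case 2. `m = 3`", "Case 3. `m = 4`", "Case 4. `5 ≤ m ≤ 9`" (p. 1191) and "Case 5. `m ≥ 10`" (p. 1192); the prime-power case is the sibling
`CyclotomicFermatCMTypesPrimePowerLevelSimple` (no odd character mod `pⁿ` has `B_{1,χ} = 0`).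

THIS FILE is glue only: it assembles the siblings' theorems — `primePow_goodness` (`ω(N) = 1`, `S₀ = ∅`), `exists_goodFinset_two_primes`
(`CyclotomicFermatCMTypesTwoPrimeLevelSimple`), `exists_goodFinset_three_primes` (`…ThreePrimeLevelSimple`), `exists_goodFinset_four_primes` ∕
`exists_goodFinset_five_primes` (`…BadCharacterCriterion`) and `exists_goodFinset_six_to_nine_primes` (`…SixToNinePrimeLevelSimple`) — into ONE
statement over `N.primeFactors.card ≤ 9`, rewriting `N = ∏_{p ∣ N} p^{v_p(N)}` (`Nat.prod_primeFactors_pow_factorization`) through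
`Finset.card_eq_one ∕ two ∕ three`, and feeds it to the `…_of_card` theorems of `CyclotomicFermatCMTypesOddLevelSimple`.

* §1 `exists_goodFinset_of_card_primeFactors_le_nine`, `twelve_mul_card_bad_lt_totient_of_card_primeFactors_le_nine` — the Proposition
  (`12·#S₀(N) < φ(N)`) at every `N > 1` with `ω(N) ≤ 9` and all prime factors `≥ 5`.
* §2 the `…_of_card_primeFactors_le_nine` family — Theorem 1 (i), (∗), Theorem 2 (stabiliser / CM type / variety), Theorem 1 (ii) there.

K–R's "Case 5. `m ≥ 10`" (prime-counting estimates, p. 1192) is NOT formalized; for `ω(N) ≥ 10` Theorems 1–2 remain available under the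
hypothesis `12·#S₀ < φ(N)` (`…_of_card`).  No new definitions, no named facts.
-/

open NumberField

namespace Literature.AlgebraicGeometry.ComplexMultiplication

open Literature.NumberTheory.ComplexMultiplication
open Literature.NumberTheory.LFunctions

namespace CyclotomicFermatCMType

/-! ## §1 Assembly: the Proposition at EVERY level prime to `6` with `ω(N) ≤ 9` -/

section UpToNine

variable {N : ℕ}

/-- **THE PROPOSITION FOR `ω(N) ≤ 9`** (K–R's Cases 1–4 assembled): if `N > 1` has at most nine prime factors, all `≥ 5`, there is a finset `S₀`
containing every odd character mod `N` with `B_{1,χ} = 0` and `12·#S₀ < φ(N)` — from the siblings' prime-power (`S₀ = ∅`), two-prime, three-prime,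
four/five-prime and six-to-nine-prime theorems. [cite: KoblitzRohrlich1978, §2 Proposition (p. 1190), Cases 1–4 (pp. 1191–1192)] -/
theorem exists_goodFinset_of_card_primeFactors_le_nine [NeZero N] (hN1 : 1 < N) (h9 : N.primeFactors.card ≤ 9)
    (h5 : ∀ ℓ ∈ N.primeFactors, 5 ≤ ℓ) :
    ∃ S₀ : Finset (DirichletCharacter ℂ N),
      (∀ ψ : DirichletCharacter ℂ N, ψ.Odd → bernoulliOneChar ψ = 0 → ψ ∈ S₀) ∧ 12 * S₀.card < N.totient := by
  classical
  have hN0 : N ≠ 0 := by omega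
  -- `N = ∏_{p ∣ N} p^{v_p(N)}`
  have hNfac : ∏ p ∈ N.primeFactors, p ^ N.factorization p = N := (Nat.prod_primeFactors_pow_factorization hN0).symm
  have hexp : ∀ p ∈ N.primeFactors, N.factorization p ≠ 0 := fun p hp =>
    Finsupp.mem_support_iff.1 (by rwa [Nat.support_factorization])
  have hm : N.primeFactors.card = 0 ∨ N.primeFactors.card = 1 ∨ N.primeFactors.card = 2 ∨ N.primeFactors.card = 3 ∨
      N.primeFactors.card = 4 ∨ N.primeFactors.card = 5 ∨ 6 ≤ N.primeFactors.card := by omega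
  rcases hm with h | h | h | h | h | h | h
  · -- no prime factor: `N ≤ 1`
    rw [Finset.card_eq_zero, Nat.primeFactors_eq_empty] at h
    omega
  · -- prime power
    obtain ⟨p, hs⟩ := Finset.card_eq_one.1 h
    have hp : p ∈ N.primeFactors := by rw [hs]; exact Finset.mem_singleton_self p
    haveI := Fact.mk (Nat.prime_of_mem_primeFactors hp)
    obtain ⟨a, ha⟩ : ∃ a, N.factorization p = a := ⟨_, rfl⟩
    rw [hs, Finset.prod_singleton, ha] at hNfac
    subst hNfac
    exact ⟨∅, primePow_goodness⟩
  · -- two primes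
    obtain ⟨p, q, hpq, hs⟩ := Finset.card_eq_two.1 h
    have hp : p ∈ N.primeFactors := by rw [hs]; simp
    have hq : q ∈ N.primeFactors := by rw [hs]; simp
    haveI := Fact.mk (Nat.prime_of_mem_primeFactors hp)
    haveI := Fact.mk (Nat.prime_of_mem_primeFactors hq)
    rw [hs, Finset.prod_pair hpq] at hNfac
    exact exists_goodFinset_two_primes (h5 p hp) (h5 q hq) hpq (hexp p hp) (hexp q hq) hNfac.symm
  · -- three primes
    obtain ⟨p, q, r, hpq, hpr, hqr, hs⟩ := Finset.card_eq_three.1 h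
    have hp : p ∈ N.primeFactors := by rw [hs]; simp
    have hq : q ∈ N.primeFactors := by rw [hs]; simp
    have hr : r ∈ N.primeFactors := by rw [hs]; simp
    have hnot : p ∉ ({q, r} : Finset ℕ) := by simp [hpq, hpr]
    rw [hs, Finset.prod_insert hnot, Finset.prod_pair hqr, ← mul_assoc] at hNfac
    exact exists_goodFinset_three_primes (Nat.prime_of_mem_primeFactors hp) (Nat.prime_of_mem_primeFactors hq)
      (Nat.prime_of_mem_primeFactors hr) (h5 p hp) (h5 q hq) (h5 r hr) hpq hpr hqr (hexp p hp) (hexp q hq) (hexp r hr) hNfac.symm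
  · exact exists_goodFinset_four_primes h h5
  · exact exists_goodFinset_five_primes h h5
  · exact exists_goodFinset_six_to_nine_primes h h9 h5

/-- **`12·#S₀(N) < φ(N)` for `ω(N) ≤ 9`**, all prime factors `≥ 5`. [cite: KoblitzRohrlich1978, §2 Proposition (p. 1190), Cases 1–4 (pp. 1191–1192)] -/
theorem twelve_mul_card_bad_lt_totient_of_card_primeFactors_le_nine [NeZero N] (hN1 : 1 < N) (h9 : N.primeFactors.card ≤ 9)
    (h5 : ∀ ℓ ∈ N.primeFactors, 5 ≤ ℓ) :
    12 * Nat.card {χ : DirichletCharacter ℂ N // χ.Odd ∧ bernoulliOneChar χ = 0} < N.totient := by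
  obtain ⟨S₀, hS₀, hcard⟩ := exists_goodFinset_of_card_primeFactors_le_nine hN1 h9 h5
  refine lt_of_le_of_lt (Nat.mul_le_mul_left _ ?_) hcard
  rw [← Nat.card_eq_finsetCard S₀]
  exact Nat.card_le_card_of_injective (fun χ => (⟨χ.1, hS₀ χ.1 χ.2.1 χ.2.2⟩ : S₀)) fun χ χ' h => by
    simpa [Subtype.ext_iff] using h

end UpToNine

/-! ## §2 Theorems 1 (i)–(ii) and 2, relatively prime case, UNCONDITIONALLY at every level `N > 1` prime to `6` with `ω(N) ≤ 9` -/

section UpToNineLevel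

open CategoryTheory
open Literature.AlgebraicGeometry.Motives (AbelianVariety)
open Literature.AlgebraicGeometry.HodgeTheory
open Literature.AlgebraicGeometry.Pohlmann1968 Literature.AlgebraicGeometry.Pohlmann1968.Cyclotomic
open CyclotomicCMTypeResidueSets (IsCMResidueSet)

variable {N : ℕ} [NeZero N]

/-- A level `> 1` with at most nine prime factors, all `≥ 5`, is odd and carries a good finset. [folklore] -/
private theorem level_hyps₉ (hN1 : 1 < N) (h9 : N.primeFactors.card ≤ 9) (h5 : ∀ ℓ ∈ N.primeFactors, 5 ≤ ℓ) :
    1 < N ∧ Odd N ∧ ∃ S₀ : Finset (DirichletCharacter ℂ N),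
      (∀ ψ : DirichletCharacter ℂ N, ψ.Odd → bernoulliOneChar ψ = 0 → ψ ∈ S₀) ∧ 12 * S₀.card < N.totient := by
  have hodd : Odd N := by
    rw [← Nat.not_even_iff_odd]
    intro he
    have h2 : 2 ∈ N.primeFactors := Nat.mem_primeFactors.2 ⟨Nat.prime_two, even_iff_two_dvd.1 he, NeZero.ne N⟩
    exact absurd (h5 2 h2) (by norm_num)
  exact ⟨hN1, hodd, exists_goodFinset_of_card_primeFactors_le_nine hN1 h9 h5⟩

/-- **THEOREM 1 (i), unconditionally, at every level `N > 1` prime to `6` with `ω(N) ≤ 9`**: for unit triples with vanishing sums and a unit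
`h`, `H_{r₂,s₂,t₂} = h⁻¹H_{r₁,s₁,t₁}` iff `{r₂,s₂,t₂} = {hr₁,hs₁,ht₁}`. [cite: KoblitzRohrlich1978, Theorem 1 (i) (p. 1185) and §2 Proposition (pp. 1190–1192)] -/
theorem forall_mem_fermatCMType_iff_iff_multiset_eq_of_card_primeFactors_le_nine (hN1 : 1 < N) (h9 : N.primeFactors.card ≤ 9)
    (h5 : ∀ ℓ ∈ N.primeFactors, 5 ≤ ℓ) {r₁ s₁ t₁ r₂ s₂ t₂ h : ZMod N}
    (hr₁ : IsUnit r₁) (hs₁ : IsUnit s₁) (ht₁ : IsUnit t₁) (h₁ : r₁ + s₁ + t₁ = 0)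
    (hr₂ : IsUnit r₂) (hs₂ : IsUnit s₂) (ht₂ : IsUnit t₂) (h₂ : r₂ + s₂ + t₂ = 0) (hh : IsUnit h) :
    (∀ x, x ∈ fermatCMType N r₂ s₂ t₂ ↔ h * x ∈ fermatCMType N r₁ s₁ t₁) ↔
      ({r₂, s₂, t₂} : Multiset (ZMod N)) = {h * r₁, h * s₁, h * t₁} := by
  obtain ⟨-, hN2, S₀, hS₀, hcard⟩ := level_hyps₉ hN1 h9 h5
  exact forall_mem_fermatCMType_iff_iff_multiset_eq_of_card hN1 hN2 S₀ hS₀ hcard hr₁ hs₁ ht₁ h₁ hr₂ hs₂ ht₂ h₂ hh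

/-- **(∗)** at such levels: `H_{r₂,s₂,t₂} = H_{r₁,s₁,t₁}` iff `{r₂,s₂,t₂} = {r₁,s₁,t₁}`. [cite: KoblitzRohrlich1978, §2 (∗) (p. 1187) and Proposition (pp. 1190–1192)] -/
theorem fermatCMType_eq_iff_multiset_eq_of_card_primeFactors_le_nine (hN1 : 1 < N) (h9 : N.primeFactors.card ≤ 9)
    (h5 : ∀ ℓ ∈ N.primeFactors, 5 ≤ ℓ) {r₁ s₁ t₁ r₂ s₂ t₂ : ZMod N}
    (hr₁ : IsUnit r₁) (hs₁ : IsUnit s₁) (ht₁ : IsUnit t₁) (h₁ : r₁ + s₁ + t₁ = 0)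
    (hr₂ : IsUnit r₂) (hs₂ : IsUnit s₂) (ht₂ : IsUnit t₂) (h₂ : r₂ + s₂ + t₂ = 0) :
    fermatCMType N r₂ s₂ t₂ = fermatCMType N r₁ s₁ t₁ ↔ ({r₂, s₂, t₂} : Multiset (ZMod N)) = {r₁, s₁, t₁} := by
  obtain ⟨-, hN2, S₀, hS₀, hcard⟩ := level_hyps₉ hN1 h9 h5
  exact fermatCMType_eq_iff_multiset_eq_of_card hN1 hN2 S₀ hS₀ hcard hr₁ hs₁ ht₁ h₁ hr₂ hs₂ ht₂ h₂

/-- **THEOREM 2's stabiliser** at such levels. [cite: KoblitzRohrlich1978, Theorem 2 (pp. 1185–1186) and Proposition (pp. 1190–1192)] -/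
theorem forall_mem_fermatCMType_one_iff_mul_mem_iff_of_card_primeFactors_le_nine (hN1 : 1 < N) (h9 : N.primeFactors.card ≤ 9)
    (h5 : ∀ ℓ ∈ N.primeFactors, 5 ≤ ℓ) {a₀ w : ZMod N} (ha₀ : IsUnit a₀) (ha₁ : IsUnit (1 + a₀)) (hw : IsUnit w) :
    (∀ x, x ∈ fermatCMType N 1 a₀ (-1 - a₀) ↔ w * x ∈ fermatCMType N 1 a₀ (-1 - a₀)) ↔
      w = 1 ∨ (1 + a₀ + a₀ ^ 2 = 0 ∧ (w = a₀ ∨ w = a₀ ^ 2)) := by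
  obtain ⟨-, hN2, S₀, hS₀, hcard⟩ := level_hyps₉ hN1 h9 h5
  exact forall_mem_fermatCMType_one_iff_mul_mem_iff_of_card hN1 hN2 S₀ hS₀ hcard ha₀ ha₁ hw

variable {L : Type} [Field L] [NumberField L] [IsCyclotomicExtension {N} ℚ L]
  {A A' : AbelianVariety ℂ} {ι : 𝓞 L →+* End A} {θ : L →+* Module.End ℂ (complexBetti A.X 1)}
  {ι' : 𝓞 L →+* End A'} {θ' : L →+* Module.End ℂ (complexBetti A'.X 1)}

/-- **THEOREM 2 on CM types** at such levels: `Φ_{(1,a₀,−1−a₀)}` primitive iff NOT (`1 + a₀ + a₀² = 0` and `a₀ ≠ 1`).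
[cite: KoblitzRohrlich1978, Theorem 2 (pp. 1185–1186) and Proposition (pp. 1190–1192)] [cite: Shimura1998, §8.2 Prop. 26] -/
theorem isPrimitive_fermat_one_iff_of_card_primeFactors_le_nine (hN1 : 1 < N) (h9 : N.primeFactors.card ≤ 9)
    (h5 : ∀ ℓ ∈ N.primeFactors, 5 ≤ ℓ) {a₀ : ZMod N} (ha₀ : IsUnit a₀) (ha₁ : IsUnit (1 + a₀))
    {hS : ∀ x : ZMod N, x.val.Coprime N → (x ∈ fermatCMType N 1 a₀ (-1 - a₀) ↔ -x ∉ fermatCMType N 1 a₀ (-1 - a₀))}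
    (φ₀ : L →+* ℂ) :
    IsPrimitive (ℂ ≃+* ℂ) (cmTypeOfResidues (L := L) (fermatCMType N 1 a₀ (-1 - a₀)) hS).1 φ₀ ↔
      ¬(1 + a₀ + a₀ ^ 2 = 0 ∧ a₀ ≠ 1) := by
  obtain ⟨-, hN2, S₀, hS₀, hcard⟩ := level_hyps₉ hN1 h9 h5
  exact isPrimitive_fermat_one_iff_of_card hN1 hN2 S₀ hS₀ hcard ha₀ ha₁ φ₀

/-- **THEOREM 2 on abelian varieties** at such levels: simple iff NOT (`1 + a₀ + a₀² = 0` and `a₀ ≠ 1`).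
[cite: KoblitzRohrlich1978, Theorem 2 (pp. 1185–1186) and Proposition (pp. 1190–1192)] [cite: Shimura1998, §8.2 Prop. 26] -/
theorem isSimple_of_fermat_one_iff_of_card_primeFactors_le_nine (hN1 : 1 < N) (h9 : N.primeFactors.card ≤ 9)
    (h5 : ∀ ℓ ∈ N.primeFactors, 5 ≤ ℓ) {a₀ : ZMod N} (ha₀ : IsUnit a₀) (ha₁ : IsUnit (1 + a₀))
    {hS : ∀ x : ZMod N, x.val.Coprime N → (x ∈ fermatCMType N 1 a₀ (-1 - a₀) ↔ -x ∉ fermatCMType N 1 a₀ (-1 - a₀))}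
    (hA : IsCMTypeRealisation (cmTypeOfResidues (L := L) (fermatCMType N 1 a₀ (-1 - a₀)) hS) A ι θ) :
    A.IsSimple ↔ ¬(1 + a₀ + a₀ ^ 2 = 0 ∧ a₀ ≠ 1) := by
  obtain ⟨-, hN2, S₀, hS₀, hcard⟩ := level_hyps₉ hN1 h9 h5
  exact isSimple_of_fermat_one_iff_of_card hN1 hN2 S₀ hS₀ hcard ha₀ ha₁ hA

/-- **THEOREM 1 (ii)** at such levels: isogeny iff `{r₂,s₂,t₂} = u·{r₁,s₁,t₁}` for a unit `u`.
[cite: KoblitzRohrlich1978, Theorem 1 (ii) (p. 1185) and Proposition (pp. 1190–1192)] [cite: Shimura1998, §8.4 Example (1) and §6.1 Corollary] -/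
theorem isIsogenous_fermatCMType_iff_exists_multiset_eq_of_card_primeFactors_le_nine [IsCMField L] (hN1 : 1 < N)
    (h9 : N.primeFactors.card ≤ 9) (h5 : ∀ ℓ ∈ N.primeFactors, 5 ≤ ℓ) {r₁ s₁ t₁ r₂ s₂ t₂ : ZMod N}
    (hr₁ : IsUnit r₁) (hs₁ : IsUnit s₁) (ht₁ : IsUnit t₁) (h₁ : r₁ + s₁ + t₁ = 0)
    (hr₂ : IsUnit r₂) (hs₂ : IsUnit s₂) (ht₂ : IsUnit t₂) (h₂ : r₂ + s₂ + t₂ = 0)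
    (hS : IsCMResidueSet N (fermatCMType N r₁ s₁ t₁)) (hS' : IsCMResidueSet N (fermatCMType N r₂ s₂ t₂))
    (hA : IsCMTypeRealisation (cmTypeOfResidues (L := L) (fermatCMType N r₁ s₁ t₁) hS.cm) A ι θ)
    (hA' : IsCMTypeRealisation (cmTypeOfResidues (L := L) (fermatCMType N r₂ s₂ t₂) hS'.cm) A' ι' θ') :
    AbelianVariety.IsIsogenous A A' ↔
      ∃ u : ZMod N, IsUnit u ∧ ({r₂, s₂, t₂} : Multiset (ZMod N)) = {u * r₁, u * s₁, u * t₁} := by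
  obtain ⟨-, hN2, S₀, hS₀, hcard⟩ := level_hyps₉ hN1 h9 h5
  exact isIsogenous_fermatCMType_iff_exists_multiset_eq_of_card hN1 hN2 S₀ hS₀ hcard hr₁ hs₁ ht₁ h₁ hr₂ hs₂ ht₂ h₂ hS hS'
    hA hA'

end UpToNineLevel

end CyclotomicFermatCMType

end Literature.AlgebraicGeometry.ComplexMultiplication
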